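import Summits.BirchSwinnertonDyer.BirchSwinnertonDyer.Theorems.QuadraticBranchSignedControlPlusKatoDivisibilityThm12OfColemanKato
import HarnessLib

/-!
# Kato Thm. 13.4 (3) ⟹ `X₀(E/ℚ_∞)` is `Λ`-torsion, from ONE non-zero Euler-system class — a route-free
# tool (K8 item 19241, lane B; reusable wherever `Kato2004_fineSelmerDual_isTorsion` is a held input)

Cell `bsd-potss` (HOME `run/shared/lean/pub/bsd-potss/`), seat `bsd-potss-k8q-c2x` g3 (prover; WIDTH-LEVER
second lane of item stmt-BirchSwinnertonDyer-19241 `PlusKatoDivisibilityBranch`, rung K8-Gss2). HONEST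
FRAMING: the programme assembles BSD for analytic rank `≤ 1` strictly from published theorems and types
the remainder; BSD is not proved by any of this; the theorems below are CONDITIONAL on Kato's Thm. 13.4
(`h134 = Kato2004.thm13_4_lengthAt_fineSelmerDual_le_of_isEulerSystemClass`) displayed as a hypothesis;
nothing closes; nothing is booked.

## What and why

The torsion of the dual fine Selmer group `X₀(E/ℚ_∞)` (Kato Thm. 12.4 (1) ∘ (17.13.1); Kobayashi Cor.
7.2) is a HELD input of many roads of the cell: the named facts `Kato2004_fineSelmerDual_isTorsion` /
`Kim2022_fineSelmerDual_isTorsion`, the FIELD `isTorsion_fine` of the Kobayashi `η`-packages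
(`EtaColemanPoitouTate{,Zeta}Data`), the `hY`/`hYt` binders of `Kato2004/DivisibilityInputsFine`. The
sibling file `…PlusKatoDivisibilityThm12OfColemanKato` (this seat) proved, INSIDE its Thm. 1.2 argument,
that on a Thm. 13.4 (3) frame this torsion is FORCED by one non-zero Euler-system class `s` with `𝐇¹_Γ/Λs`
torsion: `ℓ_𝔭(X₀) ≤ ℓ_𝔭(𝐇¹_Γ/Λs) < ⊤` at `𝔭 = (p)` and «finite local length at a principal prime ⇒
torsion» (`ColemanKatoTorsion.isTorsion_of_lengthAt_ne_top`). THIS FILE exposes that step as stand-alone,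
route-free theorems, for ANY elliptic `W/ℚ` (any reduction type at `p`):
* `fineSelmerDual_isTorsion_of_thm13_4` — `p` odd, `(κ, γ)` cyclotomic, `W[p]` irreducible, some
  `σ ∈ Gal(ℚ̄/ℚ(ζ_{p^∞}))` with `Coker(ρ(σ) − 1)` free of rank one ((12.5.2) suffices), a genuine
  Euler-system class `s ≠ 0` in the pinned `𝐇¹_Γ(T_pW)` with `𝐇¹_Γ/Λs` torsion ⟹ EVERY dual datum
  `Y : W.FineSelmerDualData κ γ` has `Y.X` torsion;
* `fineSelmerDual_isTorsion_of_thm13_4_of_injective` — the same with «`𝐇¹_Γ/Λs` torsion» discharged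
  by an INJECTIVE `Λ`-linear `c : 𝐇¹_Γ → Λ` (a Coleman map `Col ∘ loc`, Kobayashi Thm. 7.3 i); or Kato's
  `𝐇¹ ↪ Λ` from Thm. 12.4 (2)): `c(s)·x ∈ Λs` for all `x`;
* `fineSelmerDual_isTorsion_of_thm13_4_of_onto` — on a TOWER-ONTO row (`ρ̄_{W,p^m}` onto for all `m`)
  both image hypotheses are automatic (`NonEisenstein…`, `Kato2004.exists_quotient_range_sub_one_equiv_of
  _imageContainsSL2`).
Consequence for the typed inputs (for the planner / typer, no action required): on every frame where a
Coleman-type injective functional and an Euler-system-pinned class are held (the `η`-package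
`thm62_63_73_etaColemanPoitouTate_zeta` on tower-onto rows of K8: `c := colPlus`, `s := z`,
`colPlus z = L_p⁺(V, η, X) ≠ 0`), the separately held `X₀`-torsion (the package FIELD `isTorsion_fine`,
Kobayashi Cor. 7.2 at `η`) is IMPLIED by Kato Thm. 13.4 (3) — the field could be dropped from the
package on those rows without loss.

References: [Kato2004Asterisque] Thm. 12.4 (p. 221), (12.5.2) (p. 222), Thm. 13.4 (3) (p. 226), (17.13.1)
(p. 279); [Kobayashi2003] Cor. 7.2, Thm. 7.3 i) (p. 13); [Washington1997] §13.2.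
-/

noncomputable section

set_option linter.dupNamespace false

open scoped Classical

open Field WeierstrassCurve
open Literature.NumberTheory.EllipticCurves
open Literature.NumberTheory.EllipticCurves.Module
open Literature.NumberTheory.GaloisRepresentations

namespace Summit.BirchSwinnertonDyer.BirchSwinnertonDyer.Theorems

namespace ColemanKatoTorsion

variable {p : ℕ} [Fact p.Prime] {W : WeierstrassCurve ℚ} [W.IsElliptic]
  [ContinuousSMul ℤ_[p] (W.tateModule p)] [Module.Free ℤ_[p] (W.tateModule p)]
  [Module.Finite ℤ_[p] (W.tateModule p)]
  {κ : ZpExtension ℚ p} {γ : absoluteGaloisGroup ℚ}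

/-- **Kato Thm. 13.4 (3) ⟹ `X₀(E/ℚ_∞)` is `Λ`-torsion**, for ANY elliptic `W/ℚ` (any reduction at `p`):
`p` odd, `(κ, γ)` the cyclotomic pair, `I` the pinned `𝐇¹_Γ(T_pW)`, `s ∈ 𝐇¹_Γ` a GENUINE Euler-system
class, `s ≠ 0`, with `𝐇¹_Γ/Λs` torsion, `W[p]` irreducible and some `σ ∈ Gal(ℚ̄/ℚ(ζ_{p^∞}))` with
`Coker(ρ(σ) − 1)` free of rank one. Then every Pontryagin-dual datum `Y` of `Sel₀(ℚ_∞, E[p^∞])` has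
`Y.X` torsion: Thm. 13.4 (3) at the height-one prime `(p)` gives `ℓ_{(p)}(X₀) ≤ ℓ_{(p)}(𝐇¹_Γ/Λs)`,
finite for the finitely generated torsion quotient, and a module of finite local length at a
principal prime is torsion (`isTorsion_of_lengthAt_ne_top`). CONDITIONAL on `h134`; no torsion
hypothesis on `X₀` anywhere. [cite: Kato2004Asterisque, Thm. 13.4 (3) (p. 226), Thm. 12.4 (1) (p. 221)]
[cite: Washington1997, §13.2] -/
theorem fineSelmerDual_isTorsion_of_thm13_4
    (h134 : Kato2004.thm13_4_lengthAt_fineSelmerDual_le_of_isEulerSystemClass)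
    (hp2 : p ≠ 2) (hκ : κ.IsCyclotomic) (hγ : κ.IsTopGenerator γ) (I : Kato2004.IwasawaH1Data W p κ γ)
    {s : I.H} (hs : Kato2004.IsEulerSystemClass W p κ γ I s) (hs0 : s ≠ 0)
    (hQ : Module.IsTorsion (IwasawaAlgebra p) (I.H ⧸ Submodule.span (IwasawaAlgebra p) {s}))
    (hirr : W.HasIrreducibleModPGaloisRep p)
    (h3 : ∃ σ : absoluteGaloisGroup ℚ,
      (∀ (n : ℕ) (t : AlgebraicClosure ℚ), t ^ p ^ n = 1 → σ • t = t) ∧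
        Nonempty (((W.tateModule p) ⧸ LinearMap.range (W.galoisRepTate p σ - 1)) ≃ₗ[ℤ_[p]] ℤ_[p]))
    (Y : W.FineSelmerDualData κ γ) : Module.IsTorsion (IwasawaAlgebra p) Y.X := by
  haveI : Module.Finite (IwasawaAlgebra p) I.H :=
    Kato2004.IwasawaH1Data.module_finite_of_isCyclotomic hκ hγ I
  haveI : Module.Finite (IwasawaAlgebra p) Y.X :=
    WeierstrassCurve.FineSelmerDualData.module_finite _ κ hγ Y
  have hv : ∃ σ : absoluteGaloisGroup ℚ,
      (∀ (n : ℕ) (t : AlgebraicClosure ℚ), t ^ p ^ n = 1 → σ • t = t) ∧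
        Module.finrank ℤ_[p] ((W.tateModule p) ⧸ LinearMap.range (W.galoisRepTate p σ - 1)) = 1 := by
    obtain ⟨σ, hσ, ⟨eqv⟩⟩ := h3
    exact ⟨σ, hσ, by rw [eqv.finrank_eq, Module.finrank_self]⟩
  obtain ⟨-, h3'⟩ := h134 W p κ γ hp2 hκ hγ I Y s hs hs0 hv
  let 𝔭 : PrimeSpectrum (IwasawaAlgebra p) :=
    ⟨IwasawaAlgebra.augIdealP p, IwasawaAlgebra.isPrime_augIdealP_holds p⟩
  have hQfin : lengthAt (IwasawaAlgebra p) (I.H ⧸ Submodule.span (IwasawaAlgebra p) {s}) 𝔭 ≠ ⊤ :=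
    lengthAt_ne_top_of_isTorsion p _ hQ 𝔭 rfl
  exact isTorsion_of_lengthAt_ne_top (IwasawaAlgebra.prime_C p) 𝔭 rfl
    (ne_top_of_le_ne_top hQfin (h3' hirr h3 𝔭 (by exact IwasawaAlgebra.height_augIdealP_holds p)))

/-- **The same with `𝐇¹_Γ/Λs` torsion discharged by an injective functional** — an INJECTIVE
`Λ`-linear `c : 𝐇¹_Γ(T_pW) → Λ` (a Coleman map `Col^± ∘ loc`, Kobayashi Thm. 7.3 i); or any embedding
`𝐇¹_Γ ↪ Λ`, Kato Thm. 12.4 (2)): `c(s)·x − c(x)·s ∈ ker c = 0`, so `𝐇¹_Γ/Λs` is killed by `c(s) ≠ 0`.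
CONDITIONAL on `h134`. [cite: Kato2004Asterisque, Thm. 13.4 (3) (p. 226), Thm. 12.4 (2) (p. 221)]
[cite: Kobayashi2003, Thm. 7.3 i) and Cor. 7.2 (p. 13)] -/
theorem fineSelmerDual_isTorsion_of_thm13_4_of_injective
    (h134 : Kato2004.thm13_4_lengthAt_fineSelmerDual_le_of_isEulerSystemClass)
    (hp2 : p ≠ 2) (hκ : κ.IsCyclotomic) (hγ : κ.IsTopGenerator γ) (I : Kato2004.IwasawaH1Data W p κ γ)
    (c : I.H →ₗ[IwasawaAlgebra p] IwasawaAlgebra p) (hc : Function.Injective c)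
    {s : I.H} (hs : Kato2004.IsEulerSystemClass W p κ γ I s) (hs0 : s ≠ 0)
    (hirr : W.HasIrreducibleModPGaloisRep p)
    (h3 : ∃ σ : absoluteGaloisGroup ℚ,
      (∀ (n : ℕ) (t : AlgebraicClosure ℚ), t ^ p ^ n = 1 → σ • t = t) ∧
        Nonempty (((W.tateModule p) ⧸ LinearMap.range (W.galoisRepTate p σ - 1)) ≃ₗ[ℤ_[p]] ℤ_[p]))
    (Y : W.FineSelmerDualData κ γ) : Module.IsTorsion (IwasawaAlgebra p) Y.X := by
  have hcs0 : c s ≠ 0 := fun h ↦ hs0 (hc (by rw [h, map_zero]))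
  have hby := EulerSystemBound.isTorsionBy_quotient_span_singleton_of_injective c hc s
  exact fineSelmerDual_isTorsion_of_thm13_4 h134 hp2 hκ hγ I hs hs0
    (fun x ↦ ⟨⟨c s, mem_nonZeroDivisors_of_ne_zero hcs0⟩, @hby x⟩) hirr h3 Y

/-- **On a TOWER-ONTO row the image hypotheses are automatic**: if `ρ̄_{W,p^m}` is onto for every `m`
(`p` odd), then `W[p]` is irreducible and (12.5.2) yields a `σ ∈ Gal(ℚ̄/ℚ(ζ_{p^∞}))` with
`Coker(ρ(σ) − 1) ≃ ℤ_p`; so an injective functional `c` and one non-zero Euler-system class `s` give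
`X₀(W/ℚ_∞)` torsion. For the K8 `η`-package `thm62_63_73_etaColemanPoitouTate_zeta` (`c := colPlus`,
`s := z`, `colPlus z = L_p⁺(V, η, X) ≠ 0`) this says: the package FIELD `isTorsion_fine` (Kobayashi
Cor. 7.2 at `η`) is implied by Kato Thm. 13.4 (3) on the tower-onto rows. CONDITIONAL on `h134`.
[cite: Kato2004Asterisque, (12.5.2) (p. 222) and Thm. 13.4 (3) (p. 226)] [cite: Kobayashi2003, Cor. 7.2 (p. 13)] -/
theorem fineSelmerDual_isTorsion_of_thm13_4_of_onto
    (h134 : Kato2004.thm13_4_lengthAt_fineSelmerDual_le_of_isEulerSystemClass)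
    (hp2 : p ≠ 2) (hκ : κ.IsCyclotomic) (hγ : κ.IsTopGenerator γ) (I : Kato2004.IwasawaH1Data W p κ γ)
    (c : I.H →ₗ[IwasawaAlgebra p] IwasawaAlgebra p) (hc : Function.Injective c)
    {s : I.H} (hs : Kato2004.IsEulerSystemClass W p κ γ I s) (hs0 : s ≠ 0)
    (hsurj : ∀ m : ℕ, W.HasSurjectiveModNGaloisRep (p ^ m : ℕ))
    (Y : W.FineSelmerDualData κ γ) : Module.IsTorsion (IwasawaAlgebra p) Y.X := by
  haveI : NeZero ((p : ℕ) : ℚ) := ⟨Nat.cast_ne_zero.mpr (Fact.out : p.Prime).ne_zero⟩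
  have hirr : W.HasIrreducibleModPGaloisRep p :=
    hasIrreducibleModPGaloisRep_of_hasSurjectiveModNGaloisRep W p (by simpa using hsurj 1)
  exact fineSelmerDual_isTorsion_of_thm13_4_of_injective h134 hp2 hκ hγ I c hc hs hs0 hirr
    (Kato2004.exists_quotient_range_sub_one_equiv_of_imageContainsSL2 W p
      (Kato2004.imageContainsSL2_of_forall_hasSurjectiveModNGaloisRep W p hsurj)) Y

end ColemanKatoTorsion

end Summit.BirchSwinnertonDyer.BirchSwinnertonDyer.Theorems

end
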